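import Summits.CriticalPhenomena.PercolationContinuityZ3.Theorems.PercNearOneGluingNoHeavyLowerTailSahiSunflowerFourCubicLayerA
import Mathlib.Tactic.Linarith
import Mathlib.Tactic.Ring
import HarnessLib

/-!
# `NoHeavyLowerTail` (crux stmt-CriticalPhenomena-4575), master-family line P2: the `M₄` hierarchy theorem, cubic layer — types 5–8 and the
# theorem `SahiPositive 2 ∧ (quartic row) ⟹ SahiPositive 3`

Support file (seat `prim-masterthm-p2`, gen 2; `--supports stmt-CriticalPhenomena-4575`); no named fact, no sorry.  Companion of
`…SahiSunflowerFourHierarchy.lean` (tables, symmetry) and `…SahiSunflowerFourPoint.lean` (`M4`, the quartic row).  Memo SAHI-ROUTE.md §4.10–4.11.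

THEOREM (this file + `…CubicLayerB`): on the four-petal sunflower poset `M₄`, `SahiPositive ν 2 ∧ E₄(D₀,D₁,D₂,D₃) ≥ 0 ⟹ SahiPositive ν 3` — the
QUARTIC row implies every cubic of the algebra (64 antichain cubics in 9 symmetry types; 5 types follow from `SahiPositive 2` alone, 4 need the
row).  Each type lemma is a degree-`≤ 4` Positivstellensatz certificate found by linear programming (kit jobs j085543/j085689, exact rational
verification by two independent programs) and RE-DERIVED here by `linarith` from the listed products `monomial × E₂(pair)` / `monomial × row`:
the LP only tells `linarith` which products to use.  Types in this file: `{0,1},{0,2},{1,2,3}`; `{0,1},{0,2},{1,3}`; `{0,1},{0,2,3},{1,2,3}`; `{0,1,2},{0,1,3},{0,2,3}`; then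
`cert_all3` (dispatch over the nine representatives), `sahiE_three_setInd_nonneg_of_two_of_row` (classification `classify3` + petal/slot
transport + the nested-pair peel) and **`sahiPositive_three_of_two_of_row`**.
-/

namespace Summit.CriticalPhenomena.PercolationContinuityZ3.Theorems.SahiDeltaSystem
namespace M4
open Finset Function Literature.Combinatorics.Sahi2008

/-- Certificate (type 5): `E_3` of the `U`-family with index sets `[[0, 1], [0, 2], [1, 2, 3]]` is `≥ 0` given `SahiPositive 2` and the quartic row; `linarith` over 33 product terms found by LP, after multiplying the target by a positive factor. [this work] -/
theorem cert3_5 {ν : M4 → ℝ} (hν0 : ∀ x, 0 ≤ ν x) (hν1 : ∑ x, ν x = 1) (hS2 : SahiPositive ν 2)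
    (h4 : 0 ≤ sahiE ν 4 ![setInd (D 0), setInd (D 1), setInd (D 2), setInd (D 3)]) :
    0 ≤ sahiE ν 3 ![setInd (U {0, 1}), setInd (U {0, 2}), setInd (U {1, 2, 3})] := by
  have hs := sum_one_eq hν1
  have ha := hν0 core; have h0 := hν0 (pet 0); have h1 := hν0 (pet 1); have h2 := hν0 (pet 2); have h3 := hν0 (pet 3)
  have hbE : ν out = 1 - ν core - ν (pet 0) - ν (pet 1) - ν (pet 2) - ν (pet 3) := by linarith
  have hB : 0 ≤ (1 - ν core - ν (pet 0) - ν (pet 1) - ν (pet 2) - ν (pet 3)) := by have := hν0 out; linarith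
  have hT : sahiE ν 3 ![setInd (U {0, 1}), setInd (U {0, 2}), setInd (U {1, 2, 3})] = ((1:ℝ) * ν (pet 3) + (1:ℝ) * ν core + (-1:ℝ) * ν (pet 3) * ν (pet 3) + (-1:ℝ) * ν (pet 2) * ν (pet 3) + (-1:ℝ) * ν (pet 1) * ν (pet 3) + (-1:ℝ) * ν (pet 1) * ν (pet 2) + (-1:ℝ) * ν (pet 0) * ν (pet 3) + (-1:ℝ) * ν (pet 0) * ν (pet 2) + (-1:ℝ) * ν (pet 0) * ν (pet 1) + (-1:ℝ) * ν core * ν (pet 3) + (-1:ℝ) * ν core * ν (pet 2) + (-1:ℝ) * ν core * ν (pet 1) + (-1:ℝ) * ν core * ν (pet 0) + (-1:ℝ) * ν (pet 0) * ν (pet 3) * ν (pet 3) + (-1:ℝ) * ν (pet 0) * ν (pet 2) * ν (pet 3) + (-1:ℝ) * ν (pet 0) * ν (pet 1) * ν (pet 3) + (-1:ℝ) * ν (pet 0) * ν (pet 1) * ν (pet 2) + (-1:ℝ) * ν core * ν (pet 3) * ν (pet 3) + (-1:ℝ) * ν core * ν (pet 2) * ν (pet 3) + (-1:ℝ) * ν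 core * ν (pet 1) * ν (pet 3) + (-1:ℝ) * ν core * ν (pet 1) * ν (pet 2) + (-2:ℝ) * ν core * ν (pet 0) * ν (pet 3) + (-1:ℝ) * ν core * ν (pet 0) * ν (pet 2) + (-1:ℝ) * ν core * ν (pet 0) * ν (pet 1) + (-2:ℝ) * ν core * ν core * ν (pet 3) + (-1:ℝ) * ν core * ν core * ν (pet 2) + (-1:ℝ) * ν core * ν core * ν (pet 1) + (-1:ℝ) * ν core * ν core * ν (pet 0) + (-1:ℝ) * ν core * ν core * ν core) := by
    rw [show U {0, 1} = ({pet 0, pet 1, out} : Finset M4) from by decide, show U {0, 2} = ({pet 0, pet 2, out} : Finset M4) from by decide, show U {1, 2, 3} = ({pet 1, pet 2, pet 3, out} : Finset M4) from by decide, sahiE_three]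
    simp [ex_eq, setInd_apply]
    rw [hbE]; ring
  have hP3 : 0 ≤ ((1:ℝ) * ν (pet 3) + (1:ℝ) * ν core + (-1:ℝ) * ν (pet 3) * ν (pet 3) + (-1:ℝ) * ν (pet 2) * ν (pet 3) + (-1:ℝ) * ν (pet 1) * ν (pet 3) + (-1:ℝ) * ν (pet 0) * ν (pet 3) + (-1:ℝ) * ν (pet 0) * ν (pet 2) + (-1:ℝ) * ν (pet 0) * ν (pet 1) + (-2:ℝ) * ν core * ν (pet 3) + (-1:ℝ) * ν core * ν (pet 2) + (-1:ℝ) * ν core * ν (pet 1) + (-1:ℝ) * ν core * ν (pet 0) + (-1:ℝ) * ν core * ν core) := by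
    have h := sahiE_two_U_nonneg hS2 {0} {1, 2}
    rw [show U {0} = ({pet 0, out} : Finset M4) from by decide, show U {1, 2} = ({pet 1, pet 2, out} : Finset M4) from by decide,
      sahiE_two] at h
    simp [ex_eq, setInd_apply] at h
    rw [hbE] at h; linarith
  have hP21 : 0 ≤ ((1:ℝ) * ν core + (-1:ℝ) * ν (pet 2) * ν (pet 3) + (-1:ℝ) * ν (pet 1) * ν (pet 3) + (-1:ℝ) * ν (pet 0) * ν (pet 3) + (-1:ℝ) * ν core * ν (pet 3) + (-1:ℝ) * ν core * ν (pet 2) + (-1:ℝ) * ν core * ν (pet 1) + (-1:ℝ) * ν core * ν (pet 0) + (-1:ℝ) * ν core * ν core) := by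
    have h := sahiE_two_U_nonneg hS2 {3} {0, 1, 2}
    rw [show U {3} = ({pet 3, out} : Finset M4) from by decide, show U {0, 1, 2} = ({pet 0, pet 1, pet 2, out} : Finset M4) from by decide,
      sahiE_two] at h
    simp [ex_eq, setInd_apply] at h
    rw [hbE] at h; linarith
  have hP22 : 0 ≤ ((1:ℝ) * ν (pet 3) + (1:ℝ) * ν core + (-1:ℝ) * ν (pet 3) * ν (pet 3) + (-1:ℝ) * ν (pet 2) * ν (pet 3) + (-1:ℝ) * ν (pet 1) * ν (pet 3) + (-1:ℝ) * ν (pet 1) * ν (pet 2) + (-2:ℝ) * ν core * ν (pet 3) + (-1:ℝ) * ν core * ν (pet 2) + (-1:ℝ) * ν core * ν (pet 1) + (-1:ℝ) * ν core * ν core) := by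
    have h := sahiE_two_U_nonneg hS2 {0, 1} {0, 2}
    rw [show U {0, 1} = ({pet 0, pet 1, out} : Finset M4) from by decide, show U {0, 2} = ({pet 0, pet 2, out} : Finset M4) from by decide,
      sahiE_two] at h
    simp [ex_eq, setInd_apply] at h
    rw [hbE] at h; linarith
  have hP24 : 0 ≤ ((1:ℝ) * ν (pet 3) + (1:ℝ) * ν core + (-1:ℝ) * ν (pet 3) * ν (pet 3) + (-1:ℝ) * ν (pet 2) * ν (pet 3) + (-1:ℝ) * ν (pet 0) * ν (pet 3) + (-1:ℝ) * ν (pet 0) * ν (pet 2) + (-2:ℝ) * ν core * ν (pet 3) + (-1:ℝ) * ν core * ν (pet 2) + (-1:ℝ) * ν core * ν (pet 0) + (-1:ℝ) * ν core * ν core) := by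
    have h := sahiE_two_U_nonneg hS2 {0, 1} {1, 2}
    rw [show U {0, 1} = ({pet 0, pet 1, out} : Finset M4) from by decide, show U {1, 2} = ({pet 1, pet 2, out} : Finset M4) from by decide,
      sahiE_two] at h
    simp [ex_eq, setInd_apply] at h
    rw [hbE] at h; linarith
  have hP25 : 0 ≤ ((1:ℝ) * ν (pet 2) + (1:ℝ) * ν core + (-1:ℝ) * ν (pet 2) * ν (pet 3) + (-1:ℝ) * ν (pet 2) * ν (pet 2) + (-1:ℝ) * ν (pet 0) * ν (pet 3) + (-1:ℝ) * ν (pet 0) * ν (pet 2) + (-1:ℝ) * ν core * ν (pet 3) + (-2:ℝ) * ν core * ν (pet 2) + (-1:ℝ) * ν core * ν (pet 0) + (-1:ℝ) * ν core * ν core) := by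
    have h := sahiE_two_U_nonneg hS2 {0, 1} {1, 3}
    rw [show U {0, 1} = ({pet 0, pet 1, out} : Finset M4) from by decide, show U {1, 3} = ({pet 1, pet 3, out} : Finset M4) from by decide,
      sahiE_two] at h
    simp [ex_eq, setInd_apply] at h
    rw [hbE] at h; linarith
  have hP28 : 0 ≤ ((1:ℝ) * ν core + (-1:ℝ) * ν (pet 0) * ν (pet 3) + (-1:ℝ) * ν (pet 0) * ν (pet 2) + (-1:ℝ) * ν core * ν (pet 3) + (-1:ℝ) * ν core * ν (pet 2) + (-1:ℝ) * ν core * ν (pet 0) + (-1:ℝ) * ν core * ν core) := by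
    have h := sahiE_two_U_nonneg hS2 {0, 1} {1, 2, 3}
    rw [show U {0, 1} = ({pet 0, pet 1, out} : Finset M4) from by decide, show U {1, 2, 3} = ({pet 1, pet 2, pet 3, out} : Finset M4) from by decide,
      sahiE_two] at h
    simp [ex_eq, setInd_apply] at h
    rw [hbE] at h; linarith
  have hP30 : 0 ≤ ((1:ℝ) * ν (pet 3) + (1:ℝ) * ν core + (-1:ℝ) * ν (pet 3) * ν (pet 3) + (-1:ℝ) * ν (pet 1) * ν (pet 3) + (-1:ℝ) * ν (pet 0) * ν (pet 3) + (-1:ℝ) * ν (pet 0) * ν (pet 1) + (-2:ℝ) * ν core * ν (pet 3) + (-1:ℝ) * ν core * ν (pet 1) + (-1:ℝ) * ν core * ν (pet 0) + (-1:ℝ) * ν core * ν core) := by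
    have h := sahiE_two_U_nonneg hS2 {0, 2} {1, 2}
    rw [show U {0, 2} = ({pet 0, pet 2, out} : Finset M4) from by decide, show U {1, 2} = ({pet 1, pet 2, out} : Finset M4) from by decide,
      sahiE_two] at h
    simp [ex_eq, setInd_apply] at h
    rw [hbE] at h; linarith
  have hP32 : 0 ≤ ((1:ℝ) * ν (pet 1) + (1:ℝ) * ν core + (-1:ℝ) * ν (pet 1) * ν (pet 3) + (-1:ℝ) * ν (pet 1) * ν (pet 1) + (-1:ℝ) * ν (pet 0) * ν (pet 3) + (-1:ℝ) * ν (pet 0) * ν (pet 1) + (-1:ℝ) * ν core * ν (pet 3) + (-2:ℝ) * ν core * ν (pet 1) + (-1:ℝ) * ν core * ν (pet 0) + (-1:ℝ) * ν core * ν core) := by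
    have h := sahiE_two_U_nonneg hS2 {0, 2} {2, 3}
    rw [show U {0, 2} = ({pet 0, pet 2, out} : Finset M4) from by decide, show U {2, 3} = ({pet 2, pet 3, out} : Finset M4) from by decide,
      sahiE_two] at h
    simp [ex_eq, setInd_apply] at h
    rw [hbE] at h; linarith
  have hP34 : 0 ≤ ((1:ℝ) * ν core + (-1:ℝ) * ν (pet 0) * ν (pet 3) + (-1:ℝ) * ν (pet 0) * ν (pet 1) + (-1:ℝ) * ν core * ν (pet 3) + (-1:ℝ) * ν core * ν (pet 1) + (-1:ℝ) * ν core * ν (pet 0) + (-1:ℝ) * ν core * ν core) := by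
    have h := sahiE_two_U_nonneg hS2 {0, 2} {1, 2, 3}
    rw [show U {0, 2} = ({pet 0, pet 2, out} : Finset M4) from by decide, show U {1, 2, 3} = ({pet 1, pet 2, pet 3, out} : Finset M4) from by decide,
      sahiE_two] at h
    simp [ex_eq, setInd_apply] at h
    rw [hbE] at h; linarith
  have hP39 : 0 ≤ ((1:ℝ) * ν core + (-1:ℝ) * ν (pet 0) * ν (pet 2) + (-1:ℝ) * ν (pet 0) * ν (pet 1) + (-1:ℝ) * ν core * ν (pet 2) + (-1:ℝ) * ν core * ν (pet 1) + (-1:ℝ) * ν core * ν (pet 0) + (-1:ℝ) * ν core * ν core) := by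
    have h := sahiE_two_U_nonneg hS2 {0, 3} {1, 2, 3}
    rw [show U {0, 3} = ({pet 0, pet 3, out} : Finset M4) from by decide, show U {1, 2, 3} = ({pet 1, pet 2, pet 3, out} : Finset M4) from by decide,
      sahiE_two] at h
    simp [ex_eq, setInd_apply] at h
    rw [hbE] at h; linarith
  have hP49 : 0 ≤ ((1:ℝ) * ν core + (-1:ℝ) * ν (pet 2) * ν (pet 3) + (-1:ℝ) * ν core * ν (pet 3) + (-1:ℝ) * ν core * ν (pet 2) + (-1:ℝ) * ν core * ν core) := by
    have h := sahiE_two_U_nonneg hS2 {0, 1, 2} {0, 1, 3}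
    rw [show U {0, 1, 2} = ({pet 0, pet 1, pet 2, out} : Finset M4) from by decide, show U {0, 1, 3} = ({pet 0, pet 1, pet 3, out} : Finset M4) from by decide,
      sahiE_two] at h
    simp [ex_eq, setInd_apply] at h
    rw [hbE] at h; linarith
  have hP50 : 0 ≤ ((1:ℝ) * ν core + (-1:ℝ) * ν (pet 1) * ν (pet 3) + (-1:ℝ) * ν core * ν (pet 3) + (-1:ℝ) * ν core * ν (pet 1) + (-1:ℝ) * ν core * ν core) := by
    have h := sahiE_two_U_nonneg hS2 {0, 1, 2} {0, 2, 3}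
    rw [show U {0, 1, 2} = ({pet 0, pet 1, pet 2, out} : Finset M4) from by decide, show U {0, 2, 3} = ({pet 0, pet 2, pet 3, out} : Finset M4) from by decide,
      sahiE_two] at h
    simp [ex_eq, setInd_apply] at h
    rw [hbE] at h; linarith
  have hP51 : 0 ≤ ((1:ℝ) * ν core + (-1:ℝ) * ν (pet 0) * ν (pet 3) + (-1:ℝ) * ν core * ν (pet 3) + (-1:ℝ) * ν core * ν (pet 0) + (-1:ℝ) * ν core * ν core) := by
    have h := sahiE_two_U_nonneg hS2 {0, 1, 2} {1, 2, 3}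
    rw [show U {0, 1, 2} = ({pet 0, pet 1, pet 2, out} : Finset M4) from by decide, show U {1, 2, 3} = ({pet 1, pet 2, pet 3, out} : Finset M4) from by decide,
      sahiE_two] at h
    simp [ex_eq, setInd_apply] at h
    rw [hbE] at h; linarith
  have hROW : 0 ≤ ((2:ℝ) * ν core + (-2:ℝ) * ν (pet 2) * ν (pet 3) + (-2:ℝ) * ν (pet 1) * ν (pet 3) + (-2:ℝ) * ν (pet 1) * ν (pet 2) + (-2:ℝ) * ν (pet 0) * ν (pet 3) + (-2:ℝ) * ν (pet 0) * ν (pet 2) + (-2:ℝ) * ν (pet 0) * ν (pet 1) + (-2:ℝ) * ν core * ν (pet 3) + (-2:ℝ) * ν core * ν (pet 2) + (-2:ℝ) * ν core * ν (pet 1) + (-2:ℝ) * ν core * ν (pet 0) + (1:ℝ) * ν core * ν core + (-2:ℝ) * ν (pet 1) * ν (pet 2) * ν (pet 3) + (-2:ℝ) * ν (pet 0) * ν (pet 2) * ν (pet 3) + (-2:ℝ) * ν (pet 0) * ν (pet 1) * ν (pet 3) + (-2:ℝ) * ν (pet 0) * ν (pet 1) * ν (pet 2) + (-3:ℝ) *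 ν core * ν (pet 2) * ν (pet 3) + (-3:ℝ) * ν core * ν (pet 1) * ν (pet 3) + (-3:ℝ) * ν core * ν (pet 1) * ν (pet 2) + (-3:ℝ) * ν core * ν (pet 0) * ν (pet 3) + (-3:ℝ) * ν core * ν (pet 0) * ν (pet 2) + (-3:ℝ) * ν core * ν (pet 0) * ν (pet 1) + (-3:ℝ) * ν core * ν core * ν (pet 3) + (-3:ℝ) * ν core * ν core * ν (pet 2) + (-3:ℝ) * ν core * ν core * ν (pet 1) + (-3:ℝ) * ν core * ν core * ν (pet 0) + (-2:ℝ) * ν core * ν core * ν core + (-1:ℝ) * ν (pet 0) * ν (pet 1) * ν (pet 2) * ν (pet 3) + (-1:ℝ) * ν core * ν (pet 1) * ν (pet 2) * ν (pet 3) + (-1:ℝ) * ν core * ν (pet 0) * ν (pet 2) * ν (pet 3) + (-1:ℝ) * ν core * ν (pet 0) * ν (pet 1) * ν (pet 3) + (-1:ℝ) * ν core * ν (pet 0) * ν (pet 1) * ν (pet 2) + (-1:ℝ) * ν core * ν core * ν (pet 2) * ν (pet 3) + (-1:ℝ) * ν core * ν core * ν (pet 1) * ν (pet 3) + (-1:ℝ)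 * ν core * ν core * ν (pet 1) * ν (pet 2) + (-1:ℝ) * ν core * ν core * ν (pet 0) * ν (pet 3) + (-1:ℝ) * ν core * ν core * ν (pet 0) * ν (pet 2) + (-1:ℝ) * ν core * ν core * ν (pet 0) * ν (pet 1) + (-1:ℝ) * ν core * ν core * ν core * ν (pet 3) + (-1:ℝ) * ν core * ν core * ν core * ν (pet 2) + (-1:ℝ) * ν core * ν core * ν core * ν (pet 1) + (-1:ℝ) * ν core * ν core * ν core * ν (pet 0) + (-1:ℝ) * ν core * ν core * ν core * ν core) := by
    rw [sahiE_four_D hν1, hbE] at h4; linarith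
  rw [hT]
  have hM : 0 < ((1:ℝ) + ((2:ℝ)/11) * ν (pet 3) + ((1:ℝ)/2) * ν core) := by positivity
  refine (mul_nonneg_iff_of_pos_right hM).1 ?_
  linarith [hROW, mul_nonneg (mul_nonneg h0 h3) hP3, mul_nonneg (mul_nonneg ha h3) hP21, mul_nonneg (mul_nonneg h0 h3) hP22,
    mul_nonneg h3 hP24, mul_nonneg (mul_nonneg ha h3) hP24, mul_nonneg h3 hP25, mul_nonneg (mul_nonneg h2 h3) hP28,
    mul_nonneg h3 hP30, mul_nonneg (mul_nonneg ha h3) hP30, mul_nonneg h3 hP32, mul_nonneg (mul_nonneg h1 h3) hP34,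
    mul_nonneg (mul_nonneg hB h3) hP39, mul_nonneg h3 hP49, mul_nonneg (mul_nonneg ha h3) hP49, mul_nonneg h3 hP50,
    mul_nonneg (mul_nonneg ha h3) hP50, mul_nonneg h3 hP51, mul_nonneg (mul_nonneg ha h3) hP51, (mul_nonneg hB h3),
    (mul_nonneg h0 h3), (mul_nonneg h1 h3), (mul_nonneg h2 h3), (mul_nonneg (mul_nonneg ha h0) h3),
    (mul_nonneg (mul_nonneg ha h1) h3), (mul_nonneg (mul_nonneg ha h2) h3), (mul_nonneg (mul_nonneg hB hB) h3),
    (mul_nonneg (mul_nonneg hB h0) h3), (mul_nonneg (mul_nonneg h1 h2) h3),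
    (mul_nonneg (mul_nonneg (mul_nonneg ha ha) hB) h3), (mul_nonneg (mul_nonneg (mul_nonneg ha h1) h2) h3),
    (mul_nonneg (mul_nonneg (mul_nonneg h0 h0) h3) h3), (mul_nonneg (mul_nonneg (mul_nonneg h0 h1) h2) h3)]

/-- Certificate (type 6): `E_3` of the `U`-family with index sets `[[0, 1], [0, 2], [1, 3]]` is `≥ 0` given `SahiPositive 2` alone; `linarith` over 4 product terms found by LP. [this work] -/
theorem cert3_6 {ν : M4 → ℝ} (hν0 : ∀ x, 0 ≤ ν x) (hν1 : ∑ x, ν x = 1) (hS2 : SahiPositive ν 2) :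
    0 ≤ sahiE ν 3 ![setInd (U {0, 1}), setInd (U {0, 2}), setInd (U {1, 3})] := by
  have hs := sum_one_eq hν1
  have ha := hν0 core; have h0 := hν0 (pet 0); have h1 := hν0 (pet 1); have h2 := hν0 (pet 2); have h3 := hν0 (pet 3)
  have hbE : ν out = 1 - ν core - ν (pet 0) - ν (pet 1) - ν (pet 2) - ν (pet 3) := by linarith
  have hB : 0 ≤ (1 - ν core - ν (pet 0) - ν (pet 1) - ν (pet 2) - ν (pet 3)) := by have := hν0 out; linarith
  have hT : sahiE ν 3 ![setInd (U {0, 1}), setInd (U {0, 2}), setInd (U {1, 3})] = ((1:ℝ) * ν (pet 3) + (1:ℝ) * ν (pet 2) + (1:ℝ) * ν core + (-1:ℝ) * ν (pet 3) * ν (pet 3) + (-1:ℝ) * ν (pet 2) * ν (pet 3) + (-1:ℝ) * ν (pet 2) * ν (pet 2) + (-1:ℝ) * ν (pet 1) * ν (pet 3) + (-1:ℝ) * ν (pet 1) * ν (pet 2) + (-1:ℝ) * ν (pet 0) * ν (pet 3) + (-1:ℝ) * ν (pet 0) * ν (pet 2) + (-1:ℝ) * ν (pet 0) * ν (pet 1)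 + (-1:ℝ) * ν core * ν (pet 3) + (-1:ℝ) * ν core * ν (pet 2) + (-1:ℝ) * ν core * ν (pet 1) + (-1:ℝ) * ν core * ν (pet 0) + (-1:ℝ) * ν (pet 2) * ν (pet 3) * ν (pet 3) + (-1:ℝ) * ν (pet 2) * ν (pet 2) * ν (pet 3) + (-1:ℝ) * ν (pet 1) * ν (pet 2) * ν (pet 3) + (-1:ℝ) * ν (pet 1) * ν (pet 2) * ν (pet 2) + (-1:ℝ) * ν (pet 0) * ν (pet 3) * ν (pet 3) + (-1:ℝ) * ν (pet 0) * ν (pet 2) * ν (pet 3) + (-1:ℝ) * ν (pet 0) * ν (pet 1) * ν (pet 3) + (-1:ℝ) * ν (pet 0) * ν (pet 1) * ν (pet 2) + (-1:ℝ) * ν core * ν (pet 3) * ν (pet 3) + (-3:ℝ) * ν core * ν (pet 2) * ν (pet 3) + (-1:ℝ) * ν core * ν (pet 2) * ν (pet 2) + (-1:ℝ) * ν core * ν (pet 1) * ν (pet 3) + (-2:ℝ) * ν core * ν (pet 1) * ν (pet 2) + (-2:ℝ) * ν core * ν (pet 0) * ν (pet 3) + (-1:ℝ) * ν core * ν (pet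 0) * ν (pet 2) + (-1:ℝ) * ν core * ν (pet 0) * ν (pet 1) + (-2:ℝ) * ν core * ν core * ν (pet 3) + (-2:ℝ) * ν core * ν core * ν (pet 2) + (-1:ℝ) * ν core * ν core * ν (pet 1) + (-1:ℝ) * ν core * ν core * ν (pet 0) + (-1:ℝ) * ν core * ν core * ν core) := by
    rw [show U {0, 1} = ({pet 0, pet 1, out} : Finset M4) from by decide, show U {0, 2} = ({pet 0, pet 2, out} : Finset M4) from by decide, show U {1, 3} = ({pet 1, pet 3, out} : Finset M4) from by decide, sahiE_three]
    simp [ex_eq, setInd_apply]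
    rw [hbE]; ring
  have hP0 : 0 ≤ ((1:ℝ) * ν (pet 3) + (1:ℝ) * ν (pet 2) + (1:ℝ) * ν core + (-1:ℝ) * ν (pet 3) * ν (pet 3) + (-2:ℝ) * ν (pet 2) * ν (pet 3) + (-1:ℝ) * ν (pet 2) * ν (pet 2) + (-1:ℝ) * ν (pet 1) * ν (pet 3) + (-1:ℝ) * ν (pet 1) * ν (pet 2) + (-1:ℝ) * ν (pet 0) * ν (pet 3) + (-1:ℝ) * ν (pet 0) * ν (pet 2) + (-1:ℝ) * ν (pet 0) * ν (pet 1) + (-2:ℝ) * ν core * ν (pet 3) + (-2:ℝ) * ν core * ν (pet 2) + (-1:ℝ) * ν core * ν (pet 1) + (-1:ℝ) * ν core * ν (pet 0) + (-1:ℝ) * ν core * ν core) := by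
    have h := sahiE_two_U_nonneg hS2 {0} {1}
    rw [show U {0} = ({pet 0, out} : Finset M4) from by decide, show U {1} = ({pet 1, out} : Finset M4) from by decide,
      sahiE_two] at h
    simp [ex_eq, setInd_apply] at h
    rw [hbE] at h; linarith
  have hP4 : 0 ≤ ((1:ℝ) * ν (pet 2) + (1:ℝ) * ν core + (-1:ℝ) * ν (pet 2) * ν (pet 3) + (-1:ℝ) * ν (pet 2) * ν (pet 2) + (-1:ℝ) * ν (pet 1) * ν (pet 2) + (-1:ℝ) * ν (pet 0) * ν (pet 3) + (-1:ℝ) * ν (pet 0) * ν (pet 2) + (-1:ℝ) * ν (pet 0) * ν (pet 1) + (-1:ℝ) * ν core * ν (pet 3) + (-2:ℝ) * ν core * ν (pet 2) + (-1:ℝ) * ν core * ν (pet 1) + (-1:ℝ) * ν core * ν (pet 0) + (-1:ℝ) * ν core * ν core) := by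
    have h := sahiE_two_U_nonneg hS2 {0} {1, 3}
    rw [show U {0} = ({pet 0, out} : Finset M4) from by decide, show U {1, 3} = ({pet 1, pet 3, out} : Finset M4) from by decide,
      sahiE_two] at h
    simp [ex_eq, setInd_apply] at h
    rw [hbE] at h; linarith
  have hP31 : 0 ≤ ((1:ℝ) * ν core + (-1:ℝ) * ν (pet 2) * ν (pet 3) + (-1:ℝ) * ν (pet 1) * ν (pet 2) + (-1:ℝ) * ν (pet 0) * ν (pet 3) + (-1:ℝ) * ν (pet 0) * ν (pet 1) + (-1:ℝ) * ν core * ν (pet 3) + (-1:ℝ) * ν core * ν (pet 2) + (-1:ℝ) * ν core * ν (pet 1) + (-1:ℝ) * ν core * ν (pet 0) + (-1:ℝ) * ν core * ν core) := by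
    have h := sahiE_two_U_nonneg hS2 {0, 2} {1, 3}
    rw [show U {0, 2} = ({pet 0, pet 2, out} : Finset M4) from by decide, show U {1, 3} = ({pet 1, pet 3, out} : Finset M4) from by decide,
      sahiE_two] at h
    simp [ex_eq, setInd_apply] at h
    rw [hbE] at h; linarith
  have hP46 : 0 ≤ ((1:ℝ) * ν core + (-1:ℝ) * ν (pet 1) * ν (pet 2) + (-1:ℝ) * ν (pet 0) * ν (pet 1) + (-1:ℝ) * ν core * ν (pet 2) + (-1:ℝ) * ν core * ν (pet 1) + (-1:ℝ) * ν core * ν (pet 0) + (-1:ℝ) * ν core * ν core) := by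
    have h := sahiE_two_U_nonneg hS2 {1, 3} {0, 2, 3}
    rw [show U {1, 3} = ({pet 1, pet 3, out} : Finset M4) from by decide, show U {0, 2, 3} = ({pet 0, pet 2, pet 3, out} : Finset M4) from by decide,
      sahiE_two] at h
    simp [ex_eq, setInd_apply] at h
    rw [hbE] at h; linarith
  rw [hT]
  linarith [hP0, mul_nonneg h3 hP4, mul_nonneg ha hP31, mul_nonneg h2 hP46]

/-- Certificate (type 7): `E_3` of the `U`-family with index sets `[[0, 1], [0, 2, 3], [1, 2, 3]]` is `≥ 0` given `SahiPositive 2` and the quartic row; `linarith` over 9 product terms found by LP, after multiplying the target by a positive factor. [this work] -/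
theorem cert3_7 {ν : M4 → ℝ} (hν0 : ∀ x, 0 ≤ ν x) (hν1 : ∑ x, ν x = 1)
    (h4 : 0 ≤ sahiE ν 4 ![setInd (D 0), setInd (D 1), setInd (D 2), setInd (D 3)]) :
    0 ≤ sahiE ν 3 ![setInd (U {0, 1}), setInd (U {0, 2, 3}), setInd (U {1, 2, 3})] := by
  have hs := sum_one_eq hν1
  have ha := hν0 core; have h0 := hν0 (pet 0); have h1 := hν0 (pet 1); have h2 := hν0 (pet 2); have h3 := hν0 (pet 3)
  have hbE : ν out = 1 - ν core - ν (pet 0) - ν (pet 1) - ν (pet 2) - ν (pet 3) := by linarith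
  have hB : 0 ≤ (1 - ν core - ν (pet 0) - ν (pet 1) - ν (pet 2) - ν (pet 3)) := by have := hν0 out; linarith
  have hT : sahiE ν 3 ![setInd (U {0, 1}), setInd (U {0, 2, 3}), setInd (U {1, 2, 3})] = ((1:ℝ) * ν core + (-1:ℝ) * ν (pet 1) * ν (pet 3) + (-1:ℝ) * ν (pet 1) * ν (pet 2) + (-1:ℝ) * ν (pet 0) * ν (pet 3) + (-1:ℝ) * ν (pet 0) * ν (pet 2) + (-1:ℝ) * ν (pet 0) * ν (pet 1) + (-1:ℝ) * ν core * ν (pet 3) + (-1:ℝ) * ν core * ν (pet 2) + (-1:ℝ) * ν core * ν (pet 1) + (-1:ℝ) * ν core * ν (pet 0) + (-1:ℝ) * ν (pet 0) * ν (pet 1) * ν (pet 3) + (-1:ℝ) * ν (pet 0) * ν (pet 1) * ν (pet 2) + (-1:ℝ) * ν core * ν (pet 1) * ν (pet 3) + (-1:ℝ) * ν core * ν (pet 1) * ν (pet 2) + (-1:ℝ) * ν core * ν (pet 0) * ν (pet 3) + (-1:ℝ) * ν core * ν (pet 0) * ν (pet 2) + (-1:ℝ) * ν core * ν (pet 0)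 * ν (pet 1) + (-1:ℝ) * ν core * ν core * ν (pet 3) + (-1:ℝ) * ν core * ν core * ν (pet 2) + (-1:ℝ) * ν core * ν core * ν (pet 1) + (-1:ℝ) * ν core * ν core * ν (pet 0) + (-1:ℝ) * ν core * ν core * ν core) := by
    rw [show U {0, 1} = ({pet 0, pet 1, out} : Finset M4) from by decide, show U {0, 2, 3} = ({pet 0, pet 2, pet 3, out} : Finset M4) from by decide, show U {1, 2, 3} = ({pet 1, pet 2, pet 3, out} : Finset M4) from by decide, sahiE_three]
    simp [ex_eq, setInd_apply]
    rw [hbE]; ring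
  have hROW : 0 ≤ ((2:ℝ) * ν core + (-2:ℝ) * ν (pet 2) * ν (pet 3) + (-2:ℝ) * ν (pet 1) * ν (pet 3) + (-2:ℝ) * ν (pet 1) * ν (pet 2) + (-2:ℝ) * ν (pet 0) * ν (pet 3) + (-2:ℝ) * ν (pet 0) * ν (pet 2) + (-2:ℝ) * ν (pet 0) * ν (pet 1) + (-2:ℝ) * ν core * ν (pet 3) + (-2:ℝ) * ν core * ν (pet 2) + (-2:ℝ) * ν core * ν (pet 1) + (-2:ℝ) * ν core * ν (pet 0) + (1:ℝ) * ν core * ν core + (-2:ℝ) * ν (pet 1) * ν (pet 2) * ν (pet 3) + (-2:ℝ) * ν (pet 0) * ν (pet 2) * ν (pet 3) + (-2:ℝ) * ν (pet 0) * ν (pet 1) * ν (pet 3) + (-2:ℝ) * ν (pet 0) * ν (pet 1) * ν (pet 2) + (-3:ℝ) * ν core * ν (pet 2) * ν (pet 3) + (-3:ℝ) * ν core * ν (pet 1) * ν (pet 3) + (-3:ℝ) * ν core * ν (pet 1) * ν (pet 2) + (-3:ℝ) * ν core * ν (pet 0) * ν (pet 3) + (-3:ℝ) * ν core * ν (pet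 0) * ν (pet 2) + (-3:ℝ) * ν core * ν (pet 0) * ν (pet 1) + (-3:ℝ) * ν core * ν core * ν (pet 3) + (-3:ℝ) * ν core * ν core * ν (pet 2) + (-3:ℝ) * ν core * ν core * ν (pet 1) + (-3:ℝ) * ν core * ν core * ν (pet 0) + (-2:ℝ) * ν core * ν core * ν core + (-1:ℝ) * ν (pet 0) * ν (pet 1) * ν (pet 2) * ν (pet 3) + (-1:ℝ) * ν core * ν (pet 1) * ν (pet 2) * ν (pet 3) + (-1:ℝ) * ν core * ν (pet 0) * ν (pet 2) * ν (pet 3) + (-1:ℝ) * ν core * ν (pet 0) * ν (pet 1) * ν (pet 3) + (-1:ℝ) * ν core * ν (pet 0) * ν (pet 1) * ν (pet 2) + (-1:ℝ) * ν core * ν core * ν (pet 2) * ν (pet 3) + (-1:ℝ) * ν core * ν core * ν (pet 1) * ν (pet 3) + (-1:ℝ) * ν core * ν core * ν (pet 1) * ν (pet 2) + (-1:ℝ) * ν core * ν core * ν (pet 0) * ν (pet 3) + (-1:ℝ) * ν core * ν core * ν (pet 0) * ν (pet 2) + (-1:ℝ) * ν core * ν core * ν (pet 0) * ν (pet 1)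 + (-1:ℝ) * ν core * ν core * ν core * ν (pet 3) + (-1:ℝ) * ν core * ν core * ν core * ν (pet 2) + (-1:ℝ) * ν core * ν core * ν core * ν (pet 1) + (-1:ℝ) * ν core * ν core * ν core * ν (pet 0) + (-1:ℝ) * ν core * ν core * ν core * ν core) := by
    rw [sahiE_four_D hν1, hbE] at h4; linarith
  rw [hT]
  have hM : 0 < ((1:ℝ) + ((1:ℝ)/2) * ν core) := by positivity
  refine (mul_nonneg_iff_of_pos_right hM).1 ?_
  linarith [hROW, (mul_nonneg h2 h3), (mul_nonneg (mul_nonneg ha h2) h3), (mul_nonneg (mul_nonneg h0 h2) h3),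
    (mul_nonneg (mul_nonneg h1 h2) h3), (mul_nonneg (mul_nonneg (mul_nonneg ha ha) h2) h3),
    (mul_nonneg (mul_nonneg (mul_nonneg ha h0) h2) h3), (mul_nonneg (mul_nonneg (mul_nonneg ha h1) h2) h3),
    (mul_nonneg (mul_nonneg (mul_nonneg h0 h1) h2) h3)]

/-- Certificate (type 8): `E_3` of the `U`-family with index sets `[[0, 1, 2], [0, 1, 3], [0, 2, 3]]` is `≥ 0` given `SahiPositive 2` and the quartic row; `linarith` over 10 product terms found by LP, after multiplying the target by a positive factor. [this work] -/
theorem cert3_8 {ν : M4 → ℝ} (hν0 : ∀ x, 0 ≤ ν x) (hν1 : ∑ x, ν x = 1) (hS2 : SahiPositive ν 2)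
    (h4 : 0 ≤ sahiE ν 4 ![setInd (D 0), setInd (D 1), setInd (D 2), setInd (D 3)]) :
    0 ≤ sahiE ν 3 ![setInd (U {0, 1, 2}), setInd (U {0, 1, 3}), setInd (U {0, 2, 3})] := by
  have hs := sum_one_eq hν1
  have ha := hν0 core; have h0 := hν0 (pet 0); have h1 := hν0 (pet 1); have h2 := hν0 (pet 2); have h3 := hν0 (pet 3)
  have hbE : ν out = 1 - ν core - ν (pet 0) - ν (pet 1) - ν (pet 2) - ν (pet 3) := by linarith
  have hB : 0 ≤ (1 - ν core - ν (pet 0) - ν (pet 1) - ν (pet 2) - ν (pet 3)) := by have := hν0 out; linarith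
  have hT : sahiE ν 3 ![setInd (U {0, 1, 2}), setInd (U {0, 1, 3}), setInd (U {0, 2, 3})] = ((1:ℝ) * ν core + (-1:ℝ) * ν (pet 2) * ν (pet 3) + (-1:ℝ) * ν (pet 1) * ν (pet 3) + (-1:ℝ) * ν (pet 1) * ν (pet 2) + (-1:ℝ) * ν core * ν (pet 3) + (-1:ℝ) * ν core * ν (pet 2) + (-1:ℝ) * ν core * ν (pet 1) + (-1:ℝ) * ν (pet 1) * ν (pet 2) * ν (pet 3) + (-1:ℝ) * ν core * ν (pet 2) * ν (pet 3) + (-1:ℝ) * ν core * ν (pet 1) * ν (pet 3) + (-1:ℝ) * ν core * ν (pet 1) * ν (pet 2) + (-1:ℝ) * ν core * ν core * ν (pet 3) + (-1:ℝ) * ν core * ν core * ν (pet 2) + (-1:ℝ) * ν core * ν core * ν (pet 1) + (-1:ℝ) * ν core * ν core * ν core) := by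
    rw [show U {0, 1, 2} = ({pet 0, pet 1, pet 2, out} : Finset M4) from by decide, show U {0, 1, 3} = ({pet 0, pet 1, pet 3, out} : Finset M4) from by decide, show U {0, 2, 3} = ({pet 0, pet 2, pet 3, out} : Finset M4) from by decide, sahiE_three]
    simp [ex_eq, setInd_apply]
    rw [hbE]; ring
  have hP50 : 0 ≤ ((1:ℝ) * ν core + (-1:ℝ) * ν (pet 1) * ν (pet 3) + (-1:ℝ) * ν core * ν (pet 3) + (-1:ℝ) * ν core * ν (pet 1) + (-1:ℝ) * ν core * ν core) := by
    have h := sahiE_two_U_nonneg hS2 {0, 1, 2} {0, 2, 3}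
    rw [show U {0, 1, 2} = ({pet 0, pet 1, pet 2, out} : Finset M4) from by decide, show U {0, 2, 3} = ({pet 0, pet 2, pet 3, out} : Finset M4) from by decide,
      sahiE_two] at h
    simp [ex_eq, setInd_apply] at h
    rw [hbE] at h; linarith
  have hROW : 0 ≤ ((2:ℝ) * ν core + (-2:ℝ) * ν (pet 2) * ν (pet 3) + (-2:ℝ) * ν (pet 1) * ν (pet 3) + (-2:ℝ) * ν (pet 1) * ν (pet 2) + (-2:ℝ) * ν (pet 0) * ν (pet 3) + (-2:ℝ) * ν (pet 0) * ν (pet 2) + (-2:ℝ) * ν (pet 0) * ν (pet 1) + (-2:ℝ) * ν core * ν (pet 3) + (-2:ℝ) * ν core * ν (pet 2) + (-2:ℝ) * ν core * ν (pet 1) + (-2:ℝ) * ν core * ν (pet 0) + (1:ℝ) * ν core * ν core + (-2:ℝ) * ν (pet 1) * ν (pet 2) * ν (pet 3) + (-2:ℝ) * ν (pet 0) * ν (pet 2) * ν (pet 3) + (-2:ℝ) * ν (pet 0) * ν (pet 1) * ν (pet 3) + (-2:ℝ) * ν (pet 0) * ν (pet 1) * ν (pet 2) + (-3:ℝ) *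 ν core * ν (pet 2) * ν (pet 3) + (-3:ℝ) * ν core * ν (pet 1) * ν (pet 3) + (-3:ℝ) * ν core * ν (pet 1) * ν (pet 2) + (-3:ℝ) * ν core * ν (pet 0) * ν (pet 3) + (-3:ℝ) * ν core * ν (pet 0) * ν (pet 2) + (-3:ℝ) * ν core * ν (pet 0) * ν (pet 1) + (-3:ℝ) * ν core * ν core * ν (pet 3) + (-3:ℝ) * ν core * ν core * ν (pet 2) + (-3:ℝ) * ν core * ν core * ν (pet 1) + (-3:ℝ) * ν core * ν core * ν (pet 0) + (-2:ℝ) * ν core * ν core * ν core + (-1:ℝ) * ν (pet 0) * ν (pet 1) * ν (pet 2) * ν (pet 3) + (-1:ℝ) * ν core * ν (pet 1) * ν (pet 2) * ν (pet 3) + (-1:ℝ) * ν core * ν (pet 0) * ν (pet 2) * ν (pet 3) + (-1:ℝ) * ν core * ν (pet 0) * ν (pet 1) * ν (pet 3) + (-1:ℝ) * ν core * ν (pet 0) * ν (pet 1) * ν (pet 2) + (-1:ℝ) * ν core * ν core * ν (pet 2) * ν (pet 3) + (-1:ℝ) * ν core * ν core * ν (pet 1) * ν (pet 3) + (-1:ℝ)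 * ν core * ν core * ν (pet 1) * ν (pet 2) + (-1:ℝ) * ν core * ν core * ν (pet 0) * ν (pet 3) + (-1:ℝ) * ν core * ν core * ν (pet 0) * ν (pet 2) + (-1:ℝ) * ν core * ν core * ν (pet 0) * ν (pet 1) + (-1:ℝ) * ν core * ν core * ν core * ν (pet 3) + (-1:ℝ) * ν core * ν core * ν core * ν (pet 2) + (-1:ℝ) * ν core * ν core * ν core * ν (pet 1) + (-1:ℝ) * ν core * ν core * ν core * ν (pet 0) + (-1:ℝ) * ν core * ν core * ν core * ν core) := by
    rw [sahiE_four_D hν1, hbE] at h4; linarith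
  rw [hT]
  have hM : 0 < ((1:ℝ) + (1:ℝ) * ν (pet 0) + ((1:ℝ)/2) * ν core) := by positivity
  refine (mul_nonneg_iff_of_pos_right hM).1 ?_
  linarith [hROW, mul_nonneg (mul_nonneg ha h0) hP50, mul_nonneg (mul_nonneg h0 h2) hP50, (mul_nonneg ha h0),
    (mul_nonneg h0 h1), (mul_nonneg h0 h2), (mul_nonneg h0 h3), (mul_nonneg (mul_nonneg ha ha) h0),
    (mul_nonneg (mul_nonneg ha h0) h1), (mul_nonneg (mul_nonneg ha h0) h3)]

/-! ## Assembly of the cubic layer -/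

/-- The nine representative certificates, uniformly. [this work] -/
theorem cert_all3 {ν : M4 → ℝ} (hν0 : ∀ x, 0 ≤ ν x) (hν1 : ∑ x, ν x = 1) (hS2 : SahiPositive ν 2)
    (h4 : 0 ≤ sahiE ν 4 ![setInd (D 0), setInd (D 1), setInd (D 2), setInd (D 3)]) (i : Fin 9) :
    0 ≤ sahiE ν 3 (fun j => setInd (U (rep3 i j))) := by
  have e : (fun j => setInd (U (rep3 i j))) = ![setInd (U (rep3 i 0)), setInd (U (rep3 i 1)), setInd (U (rep3 i 2))] := by
    funext j; fin_cases j <;> rfl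
  rw [e]
  fin_cases i
  · exact cert3_0 hν0 hν1 hS2
  · exact cert3_1 hν0 hν1 hS2
  · exact cert3_2 hν0 hν1 hS2
  · exact cert3_3 hν0 hν1 hS2
  · exact cert3_4 hν0 hν1 hS2 h4
  · exact cert3_5 hν0 hν1 hS2 h4
  · exact cert3_6 hν0 hν1 hS2
  · exact cert3_7 hν0 hν1 h4
  · exact cert3_8 hν0 hν1 hS2 h4

/-- **Every cubic from order `2` and the quartic row.**  For a probability weight on `M₄` with `SahiPositive ν 2` and
`E₄(D₀,…,D₃) ≥ 0`, `E₃(χ_{W₀},χ_{W₁},χ_{W₂}) ≥ 0` for every three up-sets (antichain triples: classification `classify3`, petal transport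
`sahiE_relabel`, slot symmetry `sahiE_comp_perm`, the nine certificates; nested triples: the peel step). [this work] -/
theorem sahiE_three_setInd_nonneg_of_two_of_row {ν : M4 → ℝ} (hν0 : ∀ x, 0 ≤ ν x) (hν1 : ∑ x, ν x = 1) (hS2 : SahiPositive ν 2)
    (h4 : 0 ≤ sahiE ν 4 ![setInd (D 0), setInd (D 1), setInd (D 2), setInd (D 3)])
    (W : Fin 3 → Finset M4) (hW : ∀ i, IsUpperSet ((W i : Finset M4) : Set M4)) : 0 ≤ sahiE ν 3 (fun i => setInd (W i)) := by
  by_cases hanti : Pairwise fun i j => ¬ W j ⊆ W i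
  · have hm : ∀ i, W i ∈ upsF := fun i => (isUp_iff_mem_upsF _).1 ((isUp_iff _).1 (hW i))
    obtain ⟨e, he, h0, h1, h2⟩ := classify3 (W 0) (hm 0) (W 1) (hm 1) (W 2) (hm 2)
      (hanti (show (1 : Fin 3) ≠ 0 by decide)) (hanti (show (0 : Fin 3) ≠ 1 by decide))
      (hanti (show (2 : Fin 3) ≠ 0 by decide)) (hanti (show (0 : Fin 3) ≠ 2 by decide))
      (hanti (show (2 : Fin 3) ≠ 1 by decide)) (hanti (show (1 : Fin 3) ≠ 2 by decide))
    have hWall : ∀ j, W j = U (e.S j) := by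
      intro j; fin_cases j
      · exact h0
      · exact h1
      · exact h2
    have hWe : (fun j => setInd (W j)) =
        fun j => setInd ((U (rep3 e.rep (perms3 e.sig j))).map (relabel (perms4 e.pi)).toEmbedding) := by
      funext j; rw [U_map_relabel, ← table3_spec e he j, hWall j]
    rw [hWe, sahiE_relabel]
    have e2 : (fun j => setInd (U (rep3 e.rep (perms3 e.sig j)))) =
        fun i => (fun j => setInd (U (rep3 e.rep j))) (perms3 e.sig i) := rfl
    rw [e2, sahiE_comp_perm (ν ∘ relabel (perms4 e.pi)) 3 (perms3 e.sig) (fun j => setInd (U (rep3 e.rep j)))]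
    have hν0' : ∀ x, 0 ≤ (ν ∘ relabel (perms4 e.pi)) x := fun x => hν0 _
    have hν1' : ∑ x, (ν ∘ relabel (perms4 e.pi)) x = 1 := by rw [sum_relabel]; exact hν1
    have h4' : 0 ≤ sahiE (ν ∘ relabel (perms4 e.pi)) 4 ![setInd (D 0), setInd (D 1), setInd (D 2), setInd (D 3)] := by
      rw [row_relabel]; exact h4
    exact cert_all3 hν0' hν1' (sahiPositive_relabel (perms4 e.pi) hS2) h4' e.rep
  · unfold Pairwise at hanti
    push Not at hanti
    obtain ⟨i, j, hij, hsub⟩ := hanti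
    refine SahiCubeAllOrders.sahiE_setInd_nonneg_of_nested hν0 hν1 ?_ W hW hij hsub
    intro V hV
    exact (sahiPositive_iff_indicators ν 2).1 hS2 V hV

/-- **Theorem (`M₄`, cubic layer): Harris + the quartic row ⟹ Sahi positivity of order `3`.**  On the four-petal sunflower poset, a probability
weight that is Sahi-positive of order `2` and has `E₄(χ_{D₀},χ_{D₁},χ_{D₂},χ_{D₃}) ≥ 0` is Sahi-positive of order `3`: the single QUARTIC row
implies every cubic inequality of the algebra (memo SAHI-ROUTE §4.10(c): numerically it implies the whole hierarchy — orders `4, 5, 6` have LP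
certificates too, Lean pending). [this work] -/
theorem sahiPositive_three_of_two_of_row {ν : M4 → ℝ} (hν0 : ∀ x, 0 ≤ ν x) (hν1 : ∑ x, ν x = 1) (hS2 : SahiPositive ν 2)
    (h4 : 0 ≤ sahiE ν 4 ![setInd (D 0), setInd (D 1), setInd (D 2), setInd (D 3)]) : SahiPositive ν 3 :=
  (sahiPositive_iff_indicators ν 3).2 fun W hW => sahiE_three_setInd_nonneg_of_two_of_row hν0 hν1 hS2 h4 W hW


end M4
end Summit.CriticalPhenomena.PercolationContinuityZ3.Theorems.SahiDeltaSystem
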